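import Mathlib
import Literature.NumberTheory.Sieve.PolynomialCongruencesRootCount
import Literature.NumberTheory.Sieve.PolynomialValuesSieveSequence
import Summits.Parity.BatemanHorn.Theorems.SoloBlindSmoothPart

/-!
# Chebyshev–Markov–Nagell for every irreducible polynomial, I: the local counts

Solo seat `solo-Parity-blind` (summit `Parity`, conjunct `BatemanHorn`), session 9.  Part I of
three (`SoloBlindNagellLocal`, `SoloBlindNagellSmooth`, `SoloBlindNagell`); the theorem and its
meaning for the programme are in the module docstring of `SoloBlindNagell.lean`.

This part: for `f ∈ ℤ[X]` irreducible of degree `d ≥ 2`, the objects `absVal f k = |f(k)|`,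
`height f = ∑ |a_i|`, `bigCount f x = #{1 ≤ k ≤ x : |f(k)| has a prime factor > x}`; `f(k) ≠ 0`
(no integer root);
`|f(k)| ≤ H x^d` on `[1, x]` and `|f(k)| ≥ c k^d` eventually; the trivial count
`#{k ≤ x : q ∣ f(k)} ≤ ρ_f(q)(x/q + 1)`; and the local count
`∑_{k ≤ x} v_p(|f(k)|) ≤ ρ_f(p) x/p + B + B x/(p(p−1)) + B [p² ≤ H x^d] log_p(H x^d)` given the
uniform bound `ρ_f(p^a) ≤ B` (T. Nagell, *Zur Arithmetik der Polynome*, Abh. Math. Sem. Hamburg 1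
(1922), §1; in the tree: `Literature.NumberTheory.Sieve.exists_polyRootCountMod_prime_pow_le`).
No `sorry`, standard axioms only.
-/

open Finset Real Polynomial

namespace Summit.Parity.BatemanHorn.Theorems.SoloBlindNagellLocal

open Literature.NumberTheory.Sieve
open Summit.Parity.BatemanHorn.Theorems.SoloBlindSmoothPart

/-! ### The objects -/

/-- `|f(k)|` as a natural number. -/
def absVal (f : ℤ[X]) (k : ℕ) : ℕ := (f.eval (k : ℤ)).natAbs

/-- The naive height `H(f) = ∑_i |a_i|` (so that `|f(k)| ≤ H x^d` for `1 ≤ k ≤ x`). -/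
def height (f : ℤ[X]) : ℕ := ∑ i ∈ range (f.natDegree + 1), (f.coeff i).natAbs

/-- `E_f(x) = #{1 ≤ k ≤ x : |f(k)| has a prime factor > x}` — the edge supply of the aligned
bilinear form (every such `k` carries at least one edge `(k, p)`, `p > x`). -/
def bigCount (f : ℤ[X]) (x : ℕ) : ℕ :=
  #((Icc 1 x).filter fun k => ∃ p ∈ (absVal f k).primeFactors, x < p)

/-- Membership in the counted set, in divisibility language. -/
theorem exists_mem_primeFactors_iff (f : ℤ[X]) (x k : ℕ) (hk : absVal f k ≠ 0) :
    (∃ p ∈ (absVal f k).primeFactors, x < p) ↔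
      ∃ p : ℕ, p.Prime ∧ x < p ∧ (p : ℤ) ∣ f.eval (k : ℤ) := by
  constructor
  · rintro ⟨p, hp, hxp⟩
    rw [Nat.mem_primeFactors] at hp
    exact ⟨p, hp.1, hxp, Int.natCast_dvd.mpr hp.2.1⟩
  · rintro ⟨p, hp, hxp, hdvd⟩
    exact ⟨p, Nat.mem_primeFactors.mpr ⟨hp, Int.natCast_dvd.mp hdvd, hk⟩, hxp⟩

/-! ### An irreducible polynomial of degree `≥ 2` has no integer root -/

/-- `|f(k)| ≠ 0` for every `k` when `f` is irreducible of degree `≥ 2` (a root `k` would split off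
the factor `X − k`). -/
theorem absVal_ne_zero {f : ℤ[X]} (hirr : Irreducible f) (hdeg : 2 ≤ f.natDegree) (k : ℕ) :
    absVal f k ≠ 0 := by
  rw [absVal, ne_eq, Int.natAbs_eq_zero]
  intro h
  have hdvd : X - C (k : ℤ) ∣ f := dvd_iff_isRoot.mpr h
  obtain ⟨g, hg⟩ := hdvd
  rcases hirr.isUnit_or_isUnit hg with hu | hu
  · have h1 := natDegree_eq_zero_of_isUnit hu
    rw [natDegree_X_sub_C] at h1
    exact one_ne_zero h1
  · have hg0 : g.natDegree = 0 := natDegree_eq_zero_of_isUnit hu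
    have hf : f.natDegree ≤ 1 := by
      rw [hg]
      calc ((X - C (k : ℤ)) * g).natDegree
          ≤ (X - C (k : ℤ)).natDegree + g.natDegree := natDegree_mul_le
        _ = 1 := by rw [natDegree_X_sub_C, hg0]
    omega

/-! ### Size: `1 ≤ H`, `|f(k)| ≤ H x^d` on `[1, x]`, and `|f(k)| ≥ c k^d` eventually -/

/-- `H(f) ≥ 1` for `f ≠ 0`. -/
theorem one_le_height {f : ℤ[X]} (hf : f ≠ 0) : 1 ≤ height f := by
  have hlc : 1 ≤ (f.coeff f.natDegree).natAbs :=
    Nat.one_le_iff_ne_zero.mpr (Int.natAbs_ne_zero.mpr (leadingCoeff_ne_zero.mpr hf))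
  calc 1 ≤ (f.coeff f.natDegree).natAbs := hlc
    _ ≤ height f := by
        unfold height
        exact Finset.single_le_sum (f := fun i => (f.coeff i).natAbs) (fun _ _ => Nat.zero_le _)
          (mem_range.mpr (Nat.lt_succ_self _))

/-- `|f(k)| ≤ H x^d` for `1 ≤ k ≤ x`. -/
theorem absVal_le (f : ℤ[X]) {x k : ℕ} (hk1 : 1 ≤ k) (hkx : k ≤ x) :
    absVal f k ≤ height f * x ^ f.natDegree := by
  unfold absVal height
  rw [eval_eq_sum_range, Finset.sum_mul]
  calc (∑ i ∈ range (f.natDegree + 1), f.coeff i * (k : ℤ) ^ i).natAbs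
      ≤ ∑ i ∈ range (f.natDegree + 1), (f.coeff i * (k : ℤ) ^ i).natAbs := Int.natAbs_sum_le _ _
    _ ≤ ∑ i ∈ range (f.natDegree + 1), (f.coeff i).natAbs * x ^ f.natDegree := by
        apply Finset.sum_le_sum
        intro i hi
        rw [mem_range] at hi
        rw [Int.natAbs_mul, Int.natAbs_pow, Int.natAbs_natCast]
        apply Nat.mul_le_mul_left
        calc k ^ i ≤ x ^ i := Nat.pow_le_pow_left hkx i
          _ ≤ x ^ f.natDegree := Nat.pow_le_pow_right (by omega) (by omega)

/-- Polynomial growth from below: `c k^d ≤ |f(k)|` for `k ≥ K`, some `c > 0`. -/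
theorem exists_mul_pow_le_absVal {f : ℤ[X]} (hf : f ≠ 0) :
    ∃ c : ℝ, 0 < c ∧ ∃ K : ℕ, ∀ k : ℕ, K ≤ k → c * (k : ℝ) ^ f.natDegree ≤ (absVal f k : ℝ) := by
  set F : ℝ[X] := f.map (Int.castRingHom ℝ) with hF
  have hinj : Function.Injective (Int.castRingHom ℝ) := Int.cast_injective
  have hFdeg : F.natDegree = f.natDegree := natDegree_map_eq_of_injective hinj f
  have hFlc : F.leadingCoeff = ((f.leadingCoeff : ℤ) : ℝ) := by
    rw [hF, leadingCoeff_map_of_injective hinj f]; rfl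
  have hlc0 : F.leadingCoeff ≠ 0 := by
    rw [hFlc]; exact_mod_cast leadingCoeff_ne_zero.mpr hf
  have hequiv := Polynomial.isEquivalent_atTop_lead F
  obtain ⟨C, hC0, hC⟩ := hequiv.symm.isBigO.exists_pos
  rw [Asymptotics.isBigOWith_iff, Filter.eventually_atTop] at hC
  obtain ⟨a, ha⟩ := hC
  refine ⟨|F.leadingCoeff| / C, div_pos (abs_pos.mpr hlc0) hC0, ⌈max a 0⌉₊, fun k hk => ?_⟩
  have hka : a ≤ (k : ℝ) := by
    have h1 : max a 0 ≤ (⌈max a 0⌉₊ : ℝ) := Nat.le_ceil _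
    have h2 : (⌈max a 0⌉₊ : ℝ) ≤ k := by exact_mod_cast hk
    linarith [le_max_left a 0]
  have hb := ha (k : ℝ) hka
  have hk0 : (0 : ℝ) ≤ (k : ℝ) := Nat.cast_nonneg k
  rw [Real.norm_eq_abs, Real.norm_eq_abs, abs_mul, abs_pow, abs_of_nonneg hk0, hFdeg] at hb
  have heval : eval (k : ℝ) F = ((f.eval (k : ℤ) : ℤ) : ℝ) := by
    rw [hF, show ((k : ℕ) : ℝ) = ((k : ℤ) : ℝ) by push_cast; rfl, eval_intCast_map]; rfl
  have habs : (absVal f k : ℝ) = |eval (k : ℝ) F| := by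
    rw [heval, absVal, Nat.cast_natAbs, Int.cast_abs]
  rw [habs, div_mul_eq_mul_div, div_le_iff₀ hC0, mul_comm _ C]
  exact hb

/-! ### Counting `k ≤ x` in the root classes of `f` modulo `q` -/

/-- **The trivial estimate** (`q ∣ f(k)` only depends on `k mod q`:
`Literature.NumberTheory.Sieve.dvd_eval_iff_dvd_eval_mod`): `#{1 ≤ k ≤ x : q ∣ f(k)} ≤ ρ_f(q) (⌊x/q⌋ + 1)`. -/
theorem card_Icc_filter_dvd_le (f : ℤ[X]) (x : ℕ) {q : ℕ} (hq : 0 < q) :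
    #((Icc 1 x).filter fun k : ℕ => (q : ℤ) ∣ f.eval (k : ℤ))
      ≤ polyRootCountMod ![f] q * (x / q + 1) := by
  rw [polyRootCountMod_single]
  set S := (Icc 1 x).filter fun k : ℕ => (q : ℤ) ∣ f.eval (k : ℤ) with hS
  set T := (range q).filter fun n : ℕ => (q : ℤ) ∣ f.eval (n : ℤ) with hT
  have hmaps : Set.MapsTo (fun k : ℕ => k % q) (S : Set ℕ) (T : Set ℕ) := by
    intro k hk
    rw [Finset.mem_coe, hS, Finset.mem_filter] at hk
    rw [Finset.mem_coe, hT, Finset.mem_filter]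
    exact ⟨mem_range.mpr (Nat.mod_lt k hq), (dvd_eval_iff_dvd_eval_mod f q k).mp hk.2⟩
  rw [Finset.card_eq_sum_card_fiberwise hmaps]
  calc ∑ ν ∈ T, #(S.filter fun k => k % q = ν) ≤ ∑ _ν ∈ T, (x / q + 1) := by
        apply Finset.sum_le_sum
        intro ν hν
        have hνq : ν < q := mem_range.mp (Finset.mem_filter.mp hν).1
        calc #(S.filter fun k => k % q = ν)
            ≤ #((range (q * (x / q + 1))).filter fun k => k ≡ ν [MOD q]) := by
              apply Finset.card_le_card
              intro k hk
              rw [Finset.mem_filter] at hk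
              have hkS := hk.1
              rw [hS, Finset.mem_filter, Finset.mem_Icc] at hkS
              rw [Finset.mem_filter, mem_range]
              refine ⟨lt_of_le_of_lt hkS.1.2 (Nat.lt_mul_div_succ x hq), ?_⟩
              rw [Nat.ModEq, hk.2, Nat.mod_eq_of_lt hνq]
          _ ≤ x / q + 1 := card_filter_range_mul_modEq_le q (x / q + 1) hq ν
    _ = #T * (x / q + 1) := by rw [Finset.sum_const, smul_eq_mul]

/-! ### The local count `∑_{k ≤ x} v_p(|f(k)|)` -/

/-- `∑_{1 ≤ k ≤ x} v_p(|f(k)|) = ∑_{1 ≤ a ≤ A} #{1 ≤ k ≤ x : p^a ∣ f(k)}` with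
`A = ⌊log_p (H x^d)⌋`. -/
theorem sum_factorization_absVal_eq {f : ℤ[X]} (hirr : Irreducible f) (hdeg : 2 ≤ f.natDegree)
    (x : ℕ) {p : ℕ} (hp : p.Prime) :
    ∑ k ∈ Icc 1 x, (absVal f k).factorization p
      = ∑ a ∈ Icc 1 (Nat.log p (height f * x ^ f.natDegree)),
          #((Icc 1 x).filter fun k : ℕ => ((p ^ a : ℕ) : ℤ) ∣ f.eval (k : ℤ)) := by
  set A := Nat.log p (height f * x ^ f.natDegree) with hAdef
  have hk : ∀ k ∈ Icc 1 x, (absVal f k).factorization p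
      = ((Icc 1 A).filter (fun a => p ^ a ∣ absVal f k)).card := by
    intro k hk
    rw [Finset.mem_Icc] at hk
    apply factorization_eq_card hp (absVal_ne_zero hirr hdeg k)
    calc absVal f k ≤ height f * x ^ f.natDegree := absVal_le f hk.1 hk.2
      _ < p ^ (A + 1) := Nat.lt_pow_succ_log_self hp.one_lt _
  rw [Finset.sum_congr rfl hk]
  simp_rw [Finset.card_filter]
  rw [Finset.sum_comm]
  apply Finset.sum_congr rfl
  intro a _
  apply Finset.sum_congr rfl
  intro k _
  simp only [absVal, Int.natCast_dvd.symm]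

/-- **The local count**: with `ρ_f(p^a) ≤ B` for all `a`,
`∑_{1 ≤ k ≤ x} v_p(|f(k)|) ≤ ρ_f(p) x / p + B + B x/(p(p−1)) + B · [p² ≤ H x^d] · log_p (H x^d)`. -/
theorem sum_factorization_absVal_le {f : ℤ[X]} (hirr : Irreducible f) (hdeg : 2 ≤ f.natDegree)
    {B : ℕ} (hB : ∀ p : ℕ, p.Prime → ∀ a : ℕ, polyRootCountMod ![f] (p ^ a) ≤ B)
    (x : ℕ) {p : ℕ} (hp : p.Prime) :
    (∑ k ∈ Icc 1 x, ((absVal f k).factorization p : ℝ))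
      ≤ (polyRootCountMod ![f] p : ℝ) * x / p + B + B * x / ((p : ℝ) * (p - 1))
        + B * (if p ^ 2 ≤ height f * x ^ f.natDegree
                then (Nat.log p (height f * x ^ f.natDegree) : ℝ) else 0) := by
  have hcast : (∑ k ∈ Icc 1 x, ((absVal f k).factorization p : ℝ))
      = ∑ a ∈ Icc 1 (Nat.log p (height f * x ^ f.natDegree)),
          (#((Icc 1 x).filter fun k : ℕ => ((p ^ a : ℕ) : ℤ) ∣ f.eval (k : ℤ)) : ℝ) := by
    have := sum_factorization_absVal_eq hirr hdeg x hp
    exact_mod_cast congrArg (Nat.cast : ℕ → ℝ) this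
  rw [hcast]
  set N := height f * x ^ f.natDegree with hNdef
  set A := Nat.log p N with hAdef
  have hp2 : 2 ≤ p := hp.two_le
  have hp0 : (0 : ℝ) < p := by exact_mod_cast hp.pos
  have hp1 : (0 : ℝ) < (p : ℝ) - 1 := by
    have : (2 : ℝ) ≤ p := by exact_mod_cast hp2
    linarith
  have hB1 : polyRootCountMod ![f] p ≤ B := by simpa using hB p hp 1
  have hB0 : (0 : ℝ) ≤ B := by positivity
  have hρ0 : (0 : ℝ) ≤ polyRootCountMod ![f] p := by positivity
  have hind0 : (0 : ℝ) ≤ (if p ^ 2 ≤ N then (A : ℝ) else 0) := by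
    split_ifs <;> positivity
  have hq0 : (0 : ℝ) ≤ (B : ℝ) * x / ((p : ℝ) * (p - 1)) :=
    div_nonneg (by positivity) (mul_nonneg hp0.le hp1.le)
  have hr0 : (0 : ℝ) ≤ (polyRootCountMod ![f] p : ℝ) * x / p := by positivity
  -- the count at level `p^a` through `ρ_f(p^a)`
  have hcount : ∀ a : ℕ, (#((Icc 1 x).filter fun k : ℕ => ((p ^ a : ℕ) : ℤ) ∣ f.eval (k : ℤ)) : ℝ)
      ≤ (polyRootCountMod ![f] (p ^ a) : ℝ) * x / (p : ℝ) ^ a + polyRootCountMod ![f] (p ^ a) := by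
    intro a
    have hpa : 0 < p ^ a := pow_pos hp.pos a
    have h := card_Icc_filter_dvd_le f x hpa
    have h' : (#((Icc 1 x).filter fun k : ℕ => ((p ^ a : ℕ) : ℤ) ∣ f.eval (k : ℤ)) : ℝ)
        ≤ (polyRootCountMod ![f] (p ^ a) : ℝ) * ((x / p ^ a : ℕ) + 1 : ℝ) := by
      exact_mod_cast h
    have hdiv : ((x / p ^ a : ℕ) : ℝ) ≤ (x : ℝ) / (p : ℝ) ^ a := by
      rw [le_div_iff₀ (by positivity)]
      have := Nat.div_mul_le_self x (p ^ a)
      exact_mod_cast this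
    have hρa0 : (0 : ℝ) ≤ polyRootCountMod ![f] (p ^ a) := by positivity
    calc (#((Icc 1 x).filter fun k : ℕ => ((p ^ a : ℕ) : ℤ) ∣ f.eval (k : ℤ)) : ℝ)
        ≤ (polyRootCountMod ![f] (p ^ a) : ℝ) * ((x / p ^ a : ℕ) + 1 : ℝ) := h'
      _ ≤ (polyRootCountMod ![f] (p ^ a) : ℝ) * ((x : ℝ) / (p : ℝ) ^ a + 1) := by gcongr
      _ = _ := by ring
  rcases Nat.lt_or_ge A 1 with hA | hA
  · rw [Finset.Icc_eq_empty (by omega)]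
    simp only [Finset.sum_empty]
    have := mul_nonneg hB0 hind0
    linarith
  -- split off `a = 1`
  rw [← Finset.insert_Icc_add_one_left_eq_Icc hA, Finset.sum_insert (by simp),
    show Icc (1 + 1) A = Icc 2 A from rfl]
  have h1 : (#((Icc 1 x).filter fun k : ℕ => ((p ^ 1 : ℕ) : ℤ) ∣ f.eval (k : ℤ)) : ℝ)
      ≤ (polyRootCountMod ![f] p : ℝ) * x / p + B := by
    have := hcount 1
    rw [pow_one, pow_one] at this
    have hB1' : (polyRootCountMod ![f] p : ℝ) ≤ B := by exact_mod_cast hB1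
    have e : (#((Icc 1 x).filter fun k : ℕ => ((p ^ 1 : ℕ) : ℤ) ∣ f.eval (k : ℤ)) : ℝ)
        = (#((Icc 1 x).filter fun k : ℕ => ((p : ℕ) : ℤ) ∣ f.eval (k : ℤ)) : ℝ) := by
      rw [pow_one]
    rw [e]
    linarith
  -- the terms `a ≥ 2`
  have h2 : ∀ a ∈ Icc 2 A, (#((Icc 1 x).filter fun k : ℕ => ((p ^ a : ℕ) : ℤ) ∣ f.eval (k : ℤ)) : ℝ)
      ≤ (B : ℝ) * x * ((p : ℝ) ^ a)⁻¹ + B := by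
    intro a _
    have hc := hcount a
    have hBa : (polyRootCountMod ![f] (p ^ a) : ℝ) ≤ B := by exact_mod_cast hB p hp a
    have hpa : (0 : ℝ) < (p : ℝ) ^ a := pow_pos hp0 a
    have hx0 : (0 : ℝ) ≤ x := by positivity
    have : (polyRootCountMod ![f] (p ^ a) : ℝ) * x / (p : ℝ) ^ a ≤ (B : ℝ) * x * ((p : ℝ) ^ a)⁻¹ := by
      rw [div_eq_mul_inv]
      gcongr
    linarith
  have h3 : ∑ a ∈ Icc 2 A, (#((Icc 1 x).filter fun k : ℕ => ((p ^ a : ℕ) : ℤ) ∣ f.eval (k : ℤ)) : ℝ)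
      ≤ (B : ℝ) * x * (1 / ((p : ℝ) * (p - 1))) + B * ((Icc 2 A).card : ℝ) := by
    calc ∑ a ∈ Icc 2 A, (#((Icc 1 x).filter fun k : ℕ => ((p ^ a : ℕ) : ℤ) ∣ f.eval (k : ℤ)) : ℝ)
        ≤ ∑ a ∈ Icc 2 A, ((B : ℝ) * x * ((p : ℝ) ^ a)⁻¹ + B) := Finset.sum_le_sum h2
      _ = (B : ℝ) * x * ∑ a ∈ Icc 2 A, ((p : ℝ) ^ a)⁻¹ + B * ((Icc 2 A).card : ℝ) := by
          rw [Finset.sum_add_distrib, Finset.mul_sum, Finset.sum_const, nsmul_eq_mul]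
          ring
      _ ≤ (B : ℝ) * x * (1 / ((p : ℝ) * (p - 1))) + B * ((Icc 2 A).card : ℝ) := by
          have := sum_Icc_inv_pow_le hp2 A
          have hx0 : (0 : ℝ) ≤ (B : ℝ) * x := by positivity
          nlinarith
  have h4 : ((Icc 2 A).card : ℝ) ≤ (if p ^ 2 ≤ N then (A : ℝ) else 0) := by
    rw [Nat.card_Icc]
    split_ifs with hcase
    · have : (↑(A + 1 - 2) : ℝ) ≤ A := by
        exact_mod_cast (by omega : A + 1 - 2 ≤ A)
      exact this
    · -- `p² > N` forces `A ≤ 1`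
      have hA1 : A ≤ 1 := by
        by_contra h
        have h := Nat.succ_le_of_lt (Nat.lt_of_not_le h)
        apply hcase
        have hN0 : N ≠ 0 := by
          intro hN
          rw [hAdef, hN, Nat.log_zero_right] at hA
          omega
        calc p ^ 2 ≤ p ^ A := Nat.pow_le_pow_right hp.pos h
          _ ≤ N := by
              rw [hAdef]
              exact Nat.pow_log_le_self p hN0
      have : A + 1 - 2 = 0 := by omega
      rw [this]
      simp
  have h5 : (B : ℝ) * x * (1 / ((p : ℝ) * (p - 1))) = B * x / ((p : ℝ) * (p - 1)) := by ring
  have h6 : (B : ℝ) * ((Icc 2 A).card : ℝ) ≤ B * (if p ^ 2 ≤ N then (A : ℝ) else 0) :=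
    mul_le_mul_of_nonneg_left h4 hB0
  linarith [h1, h3, h4, h5, h6]

end Summit.Parity.BatemanHorn.Theorems.SoloBlindNagellLocal
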